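import Summits.CriticalPhenomena.PercolationContinuityZ3.Theorems.Transplant.KNCellsRunInv
import HarnessLib

/-!
# F8 (generic), part 3c — consequences of the run invariant: the explored region lies in the anchored cover ((29), (31))
# (BLUEPRINT-I-PHI §3 Φ13; generalises `L/KozmaNitzanTheorem6.lean` ll. 300–470 to an anchored cell geometry of a graph `G`)

builds on p205010 (kernel theorem, internal audit signed; external expert review pending) — nothing in this file uses p205010.
Lane `prim-bschramm`, seat `prim-bschramm-p2` (task F8 'HSR instantiation', lead V38); helper file (`--supports stmt-CriticalPhenomena-4575`).
Continuation of `KNCellsRun` / `KNCellsRunInv`.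

The PLANAR separation facts of Kozma–Nitzan's cells (KN pp. 26–29, Figure 3; `L/KozmaNitzanSteps.lean` §§ static geometry) are collected,
in anchored form, in the hypothesis structure `SepGeom G Γ` (§1): cubes inside cells, `E_{v,x}` inside the two cells, stubs inside `Q_v ∪ Btw`
and inside cell ∪ zone (the stub at a DEPARTURE anchor admissible for the ARRIVAL anchor of `Q_v`/`Cell_v`), `Efar ⊆ Btw ∪ Q_x`, the pairwise
disjointness of cubes / between-boxes / far boxes ACROSS anchors, and the column facts replacing KN's centre facts (`col x` meets every `Q · x`,
misses every other cell and every zone); `anch_refl` (an anchor is admissible for itself, for the root).  From these and `RunInv`: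
* §2 `dep_mem_anchSet` (departure anchors are admissible for arrival anchors, all along the run), `root_mem_V`, `zero_mem_occ`,
  `newRegion_subset_V`, `det_tgt_of_probe`, **`V_subset_Cover`** (the explored region lies in the cover of the determined macro-vertices at
  their CURRENT anchors), **`det_of_col`** ((29), converse: a macro-vertex whose column is explored is determined), `mem_onward_of_not_det`,
  `probe_time_unique`;
* §3 (31): `newRegion_disjoint`, **`mem_Stub_of_mem_V_of_mem_Efar`** (after the examination of `v`, while `x = v + du` is undetermined, the
  explored region meets `E_{v,x}` only inside the revealed stub `H^{j_x}_{v,x}`), `not_mem_Ewv_root_of_mem_V`.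
[cite: KozmaNitzan2024, §4 pp. 26–28 ((29), (31)) — the ℤ^d model] [cite: GrimmettPercolation1999, §7.2]
-/

noncomputable section

open MeasureTheory ProbabilityTheory
open scoped ENNReal Classical

namespace Summit.CriticalPhenomena.PercolationContinuityZ3.Theorems

namespace Transplant

namespace KNCells

open Literature.Probability.Percolation Literature.Probability.LatticeModels SimpleGraph GadgetSystem ProbeHistory HSiteScheme Contour

variable {V : Type*} [DecidableEq V]

/-! ## §1 The planar separation facts -/

/-- **The planar geometry of the cells used by (29) and (31)**, in anchored form (KN pp. 26–29, Figure 3): an anchor is admissible for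
itself; the root lies in its cube; cubes lie in cells; `E_{v,x}`'s between-box lies in the cells of `v` (arrival anchor) and `x`; a stub at an
admissible departure anchor lies in `Q_v ∪ Btw` and in `Cell_v ∪ Zone`; `Efar ⊆ Btw ∪ Q_x`; `E_{w,v}` misses the far boxes of the onward
edges of `v`; cubes of distinct macro-vertices, cubes and between-boxes, between-boxes of different macro-edges, cubes / other between-boxes
and far boxes are disjoint WHATEVER THE ANCHORS; the column of `x` meets every cube of `x`, misses the cells of the other macro-vertices and all
zones. [cite: KozmaNitzan2024, §4 pp. 26–29 (Q_v, E_{v,x}, H^j_{v,x}, Figure 3)] -/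
structure SepGeom {A : Type*} (G : SimpleGraph V) (Γ : CellGeom V A) : Prop where
  anch_refl : ∀ a v, a ∈ Γ.anchSet a v
  root_mem : Γ.root ∈ Γ.Q Γ.a₀ 0
  Q_subset_Cell : ∀ a v, Γ.Q a v ⊆ Γ.Cell a v
  Btw_subset_Cells : ∀ a a' v δ, a' ∈ Γ.anchSet a v → Γ.Btw a' v δ ⊆ Γ.Cell a v ∪ Γ.Cell a' (v + stepVec δ)
  Stub_subset_Q_union_Btw : ∀ a a' v δ j, a' ∈ Γ.anchSet a v → j + 1 ≤ Γ.K → Γ.Stub a' v δ j ⊆ Γ.Q a v ∪ Γ.Btw a' v δ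
  Stub_subset_Cell_union_Zone : ∀ a a' v δ j, a' ∈ Γ.anchSet a v → j + 1 ≤ Γ.K → Γ.Stub a' v δ j ⊆ Γ.Cell a v ∪ Γ.Zone a' v δ
  Efar_subset_Btw_union_Q : ∀ a v δ, Γ.Efar a v δ ⊆ Γ.Btw a v δ ∪ Γ.Q a (v + stepVec δ)
  Ewv_disjoint_Efar : ∀ a a' w δw du, du ≠ rev δw → Disjoint (Γ.Ewv a w δw) (Γ.Efar a' (w + stepVec δw) du)
  Q_disjoint_Q : ∀ a a' u x, u ≠ x → Disjoint (Γ.Q a u) (Γ.Q a' x)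
  Q_disjoint_Btw : ∀ a a' x v δ, Disjoint (Γ.Q a x) (Γ.Btw a' v δ)
  Btw_disjoint_Btw : ∀ a a' v δ v' δ', (v', δ') ≠ (v, δ) → (v', δ') ≠ (v + stepVec δ, rev δ) → Disjoint (Γ.Btw a v δ) (Γ.Btw a' v' δ')
  Q_disjoint_Efar : ∀ a a' v δ, Disjoint (Γ.Q a v) (Γ.Efar a' v δ)
  Btw_disjoint_Efar : ∀ a a' v δ δ', δ' ≠ δ → Disjoint (Γ.Btw a v δ') (Γ.Efar a' v δ)
  col_Q : ∀ a x, ∃ y ∈ Γ.Q a x, y ∈ Γ.col x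
  col_Cell : ∀ a u x, u ≠ x → ∀ y ∈ Γ.Cell a u, y ∉ Γ.col x
  col_Zone : ∀ a u δ x, ∀ y ∈ Γ.Zone a u δ, y ∉ Γ.col x

namespace KSchA

variable {A : Type*} {G : SimpleGraph V} [G.LocallyFinite] {S : KSchA V A}
variable (hΓ : RunGeom G S.Γ) (hsep : SepGeom G S.Γ) {ω : BondConfig V}
include hΓ hsep

/-! ## §2 (29): the explored region and the determined macro-vertices -/

omit hΓ in
/-- **Departure anchors are admissible for arrival anchors**, all along the run. [folklore] -/
theorem dep_mem_anchSet (n : ℕ) (x : Site 2) :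
    (S.astOf G (S.hst G ω n)).dep x ∈ S.Γ.anchSet ((S.astOf G (S.hst G ω n)).arr x) x := by
  induction n with
  | zero => exact hsep.anch_refl _ _
  | succ n ih =>
    rcases S.next_cases (G := G) ω n with hD | ⟨e, hc, -, hD⟩
    · obtain ⟨-, -, -, hast⟩ := S.step_none hD
      rw [hast]; exact ih
    · obtain ⟨-, -, -, harr, hdep⟩ := S.step_some hc hD
      rw [harr, hdep]
      by_cases hx : x = tgt e
      · subst hx
        rw [Function.update_self, Function.update_self]
        exact S.Γ.anchor_mem _ _ _
      · rw [Function.update_of_ne hx, Function.update_of_ne hx]; exact ih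

omit hsep in
/-- The root is explored. [folklore] -/
theorem root_mem_V (hroot : S.Γ.root ∈ S.Γ.Q S.Γ.a₀ 0) (n : ℕ) : S.Γ.root ∈ S.Vx G (S.hst G ω n) := by
  have h0 : S.Γ.root ∈ S.Vx G (S.hst G ω 0) := by
    show S.Γ.root ∈ S.Vx G []
    rw [S.V_nil hΓ]; exact hroot
  exact S.V_mono ω (Nat.zero_le n) h0

omit hΓ hsep in
/-- The macro-origin is always occupied. [folklore] -/
theorem zero_mem_occ (n : ℕ) : (0 : Site 2) ∈ ((S.scheme G).stN n ω).occ :=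
  ((S.scheme G).inv_mst _).zero_mem

omit hsep in
/-- The new region of a probe lies in the explored region afterwards. [cite: KozmaNitzan2024, §4 p. 27 (E_{i+1})] -/
theorem newRegion_subset_V {m n : ℕ} (hmn : m < n) {e : Site 2 × MDir} (hc : ((S.scheme G).stN m ω).choice = some e)
    (hD : (S.scheme G).E.next (S.hst G ω m) = some (S.probe G (S.hst G ω m) e (S.aOf G (S.hst G ω m) e))) :
    S.newR G ω (S.hst G ω m) e ⊆ S.Vx G (S.hst G ω n) := by
  have h1 := (V_step hΓ (runInv hΓ ω m) hc hD).2
  intro y hy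
  refine S.V_mono ω (Nat.succ_le_of_lt hmn) ?_
  show y ∈ S.Vx G (S.hst G ω (m + 1))
  rw [h1]; exact Finset.mem_union_right _ hy

omit hΓ hsep in
/-- The target of a probe is determined afterwards. [folklore] -/
theorem det_tgt_of_probe {m n : ℕ} (hmn : m < n) {e : Site 2 × MDir} (hc : ((S.scheme G).stN m ω).choice = some e)
    (hD : (S.scheme G).E.next (S.hst G ω m) = some (S.probe G (S.hst G ω m) e (S.aOf G (S.hst G ω m) e))) :
    ((S.scheme G).stN n ω).Det (tgt e) := by
  have hst := (S.step_some hc hD).2.2.1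
  refine (S.scheme G).det_stN_mono ω (Nat.succ_le_of_lt hmn) ?_
  rw [hst]
  exact HState.det_update_tgt _ _ _

omit hΓ hsep in
/-- The anchors of the target of a probe, from the next step on: arrival = the source anchor, departure = the one read off the observation.
[folklore] -/
theorem anchors_tgt_of_probe {m n : ℕ} (hmn : m < n) {e : Site 2 × MDir} (hc : ((S.scheme G).stN m ω).choice = some e)
    (hD : (S.scheme G).E.next (S.hst G ω m) = some (S.probe G (S.hst G ω m) e (S.aOf G (S.hst G ω m) e))) :
    (S.astOf G (S.hst G ω n)).arr (tgt e) = S.aOf G (S.hst G ω m) e ∧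
      (S.astOf G (S.hst G ω n)).dep (tgt e) = S.dOf G ω (S.hst G ω m) e := by
  obtain ⟨-, -, hst, harr, hdep⟩ := S.step_some hc hD
  have hdet : ((S.scheme G).stN (m + 1) ω).Det (tgt e) := by rw [hst]; exact HState.det_update_tgt _ _ _
  obtain ⟨h1, h2⟩ := S.anchors_eq_of_det hdet (n := n) (Nat.succ_le_of_lt hmn)
  rw [h1, h2, harr, hdep, Function.update_self, Function.update_self]
  exact ⟨rfl, rfl⟩

omit hΓ hsep in
/-- The anchors of the source of a probe do not change from the probe on (the source is occupied). [folklore] -/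
theorem anchors_src_of_probe {m n : ℕ} (hmn : m ≤ n) {e : Site 2 × MDir} (hc : ((S.scheme G).stN m ω).choice = some e) :
    (S.astOf G (S.hst G ω n)).arr e.1 = (S.astOf G (S.hst G ω m)).arr e.1 ∧
      (S.astOf G (S.hst G ω n)).dep e.1 = (S.astOf G (S.hst G ω m)).dep e.1 :=
  S.anchors_eq_of_det (Or.inl (HState.cand_of_choice hc).1) hmn

/-- **The explored region lies in the cover of the determined macro-vertices at their current anchors.**
[cite: KozmaNitzan2024, §4 pp. 26–27 ((29), (31))] -/
theorem V_subset_Cover (n : ℕ) :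
    (↑(S.Vx G (S.hst G ω n)) : Set V) ⊆
      S.Γ.Cover (S.astOf G (S.hst G ω n)).arr (S.astOf G (S.hst G ω n)).dep {x | ((S.scheme G).stN n ω).Det x} := by
  intro y hy
  have hI := runInv hΓ ω n
  simp only [CellGeom.Cover, Set.mem_iUnion, Set.mem_union, exists_prop, Finset.mem_coe, Set.mem_setOf_eq]
  rcases hI.V_cases y (Finset.mem_coe.1 hy) with h | ⟨m, hm, e, hc, -, hD, h⟩
  · refine ⟨0, Or.inl (zero_mem_occ n), Or.inl ?_⟩
    rw [hI.arr_zero]; exact hsep.Q_subset_Cell _ _ h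
  · have hsrc : ((S.scheme G).stN n ω).Det e.1 := Or.inl ((S.scheme G).occ_stN_mono ω hm.le (HState.cand_of_choice hc).1)
    have htgt : ((S.scheme G).stN n ω).Det (tgt e) := det_tgt_of_probe hm hc hD
    obtain ⟨harrT, hdepT⟩ := anchors_tgt_of_probe (S := S) hm hc hD
    obtain ⟨harrS, hdepS⟩ := anchors_src_of_probe (S := S) hm.le hc
    -- the source anchor `a = dep_m e.1` is admissible for `arr_m e.1`
    have ha : S.aOf G (S.hst G ω m) e ∈ S.Γ.anchSet ((S.astOf G (S.hst G ω m)).arr e.1) e.1 := dep_mem_anchSet hsep m e.1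
    have ha' : S.dOf G ω (S.hst G ω m) e ∈ S.Γ.anchSet (S.aOf G (S.hst G ω m) e) (tgt e) := S.Γ.anchor_mem _ _ _
    rcases Finset.mem_union.1 h with h | h
    · rcases Finset.mem_union.1 h with h | h
      · -- `Btw` lies in `Cell (arr e.1) e.1 ∪ Cell a (tgt e)`
        rcases Finset.mem_union.1 (hsep.Btw_subset_Cells _ _ _ _ ha h) with h | h
        · exact ⟨e.1, hsrc, Or.inl (by rw [harrS]; exact h)⟩
        · exact ⟨tgt e, htgt, Or.inl (by rw [harrT]; exact h)⟩
      · exact ⟨tgt e, htgt, Or.inl (by rw [harrT]; exact hsep.Q_subset_Cell _ _ h)⟩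
    · obtain ⟨du, -, h⟩ := Finset.mem_biUnion.1 h
      have hj : S.jOf G (S.hst G ω m) e (S.aOf G (S.hst G ω m) e) (S.dOf G ω (S.hst G ω m) e) du (S.oOf G ω (S.hst G ω m) e) + 1 ≤ S.Γ.K :=
        S.jOf_lt _ _ _ _ _ _
      rcases Finset.mem_union.1 (hsep.Stub_subset_Cell_union_Zone _ _ _ _ _ ha' hj h) with h | h
      · exact ⟨tgt e, htgt, Or.inl (by rw [harrT]; exact h)⟩
      · exact ⟨tgt e, htgt, Or.inr ⟨du, by rw [hdepT]; exact h⟩⟩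

/-- **(29), converse half**: a macro-vertex whose column meets the explored region is determined. [cite: KozmaNitzan2024, §4 p. 26 ((29))] -/
theorem det_of_col {n : ℕ} {x : Site 2} {y : V} (hyV : y ∈ S.Vx G (S.hst G ω n)) (hyc : y ∈ S.Γ.col x) :
    ((S.scheme G).stN n ω).Det x := by
  have hy := V_subset_Cover hΓ hsep n (Finset.mem_coe.2 hyV)
  simp only [CellGeom.Cover, Set.mem_iUnion, Set.mem_union, exists_prop, Finset.mem_coe, Set.mem_setOf_eq] at hy
  obtain ⟨u, hu, h | ⟨δ, h⟩⟩ := hy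
  · by_contra hx
    have hux : u ≠ x := fun h' => hx (h' ▸ hu)
    exact hsep.col_Cell _ _ _ hux _ h hyc
  · exact absurd hyc (hsep.col_Zone _ _ _ _ _ h)

/-- **(29), direct half**: the column of a determined macro-vertex meets the explored region. [cite: KozmaNitzan2024, §4 p. 26 ((29))] -/
theorem col_of_det {n : ℕ} {x : Site 2} (hx : ((S.scheme G).stN n ω).Det x) : ∃ y ∈ S.Vx G (S.hst G ω n), y ∈ S.Γ.col x := by
  obtain ⟨y, hy, hyc⟩ := hsep.col_Q ((S.astOf G (S.hst G ω n)).arr x) x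
  exact ⟨y, (runInv hΓ ω n).det_Q x hx hy, hyc⟩

/-- An undetermined neighbour is an onward direction of every earlier history. [cite: KozmaNitzan2024, §4 p. 27 (X = X_v)] -/
theorem mem_onward_of_not_det {m n : ℕ} (hmn : m ≤ n) {w : Site 2} {du : MDir}
    (hv : ¬((S.scheme G).stN n ω).Det (w + stepVec du)) : du ∈ S.onward G (S.hst G ω m) w :=
  Finset.mem_filter.2 ⟨Finset.mem_univ _, fun _ hy hyc =>
    hv ((S.scheme G).det_stN_mono ω hmn (det_of_col hΓ hsep hy hyc))⟩

omit hΓ hsep in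
/-- A probe's target is examined only once. [folklore] -/
theorem probe_time_unique {m m' : ℕ} {e e' : Site 2 × MDir} (hc : ((S.scheme G).stN m ω).choice = some e)
    (hD : (S.scheme G).E.next (S.hst G ω m) = some (S.probe G (S.hst G ω m) e (S.aOf G (S.hst G ω m) e)))
    (hc' : ((S.scheme G).stN m' ω).choice = some e')
    (hD' : (S.scheme G).E.next (S.hst G ω m') = some (S.probe G (S.hst G ω m') e' (S.aOf G (S.hst G ω m') e')))
    (ht : tgt e' = tgt e) : m' = m := by
  by_contra hne
  rcases lt_or_gt_of_ne hne with hlt | hlt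
  · have h1 := det_tgt_of_probe (S := S) hlt hc' hD'
    rw [ht] at h1
    exact (HState.cand_of_choice hc).2 h1
  · have h1 := det_tgt_of_probe (S := S) hlt hc hD
    rw [← ht] at h1
    exact (HState.cand_of_choice hc').2 h1

/-! ## §3 (31): nothing explored later meets `E_{v,x}` -/

omit hΓ in
/-- The new region of an examination along `e'` (at source anchor `a`, admissible departure anchor `a'`) avoids `Btw(w, du) ∪ Q_{w+du}` (any
anchors) whenever the target of `e'` is neither `w` nor `w + du` and its source is not `w + du`. [cite: KozmaNitzan2024, §4 p. 27 ((31))] -/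
theorem newRegion_disjoint (h : ProbeHistory V) (e' : Site 2 × MDir) {a a' : A} (ha' : a' ∈ S.Γ.anchSet a (tgt e')) (o : Finset (Sym2 V))
    {b b' : A} {w : Site 2} {du : MDir} (hv' : tgt e' ≠ w + stepVec du) (hv'w : tgt e' ≠ w) (hw' : e'.1 ≠ w + stepVec du)
    {y : V} (hy : y ∈ S.newRegion G h e' a a' o) : y ∉ S.Γ.Btw b w du ∧ y ∉ S.Γ.Q b' (w + stepVec du) := by
  have hQt : ∀ {z}, z ∈ S.Γ.Q a (tgt e') → z ∉ S.Γ.Btw b w du ∧ z ∉ S.Γ.Q b' (w + stepVec du) := fun hz =>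
    ⟨Finset.disjoint_left.1 (hsep.Q_disjoint_Btw _ _ (tgt e') w du) hz, Finset.disjoint_left.1 (hsep.Q_disjoint_Q _ _ _ _ hv') hz⟩
  rcases Finset.mem_union.1 hy with hy | hy
  · rcases Finset.mem_union.1 hy with hy | hy
    · refine ⟨fun hy' => ?_, Finset.disjoint_right.1 (hsep.Q_disjoint_Btw _ _ (w + stepVec du) e'.1 e'.2) hy⟩
      refine Finset.disjoint_left.1 (hsep.Btw_disjoint_Btw b a w du e'.1 e'.2 ?_ ?_) hy' hy
      · intro heq
        apply hv'
        have h1 : e'.1 = w := congrArg Prod.fst heq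
        have h2 : e'.2 = du := congrArg Prod.snd heq
        show e'.1 + stepVec e'.2 = w + stepVec du
        rw [h1, h2]
      · intro heq; exact hw' (congrArg Prod.fst heq)
    · exact hQt hy
  · obtain ⟨du'', -, hy⟩ := Finset.mem_biUnion.1 hy
    rcases Finset.mem_union.1 (hsep.Stub_subset_Q_union_Btw _ _ _ _ _ ha' (S.jOf_lt _ _ _ _ _ _) hy) with hy | hy
    · exact hQt hy
    · refine ⟨fun hy' => ?_, Finset.disjoint_right.1 (hsep.Q_disjoint_Btw _ _ (w + stepVec du) (tgt e') du'') hy⟩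
      refine Finset.disjoint_left.1 (hsep.Btw_disjoint_Btw b a' w du (tgt e') du'' ?_ ?_) hy' hy
      · intro heq; exact hv'w (congrArg Prod.fst heq)
      · intro heq; exact hv' (congrArg Prod.fst heq)

omit hΓ hsep in
/-- An onward direction of a valid examination does not point back at the source. [folklore] -/
theorem du_ne_rev {h : ProbeHistory V} {e : Site 2 × MDir} (hV : S.Valid G h e) {du : MDir} (hdu : du ∈ S.onward G h (tgt e)) :
    du ≠ rev e.2 := by
  intro hrev
  have h1 := (Finset.mem_filter.1 hdu).2
  have h2 : tgt e + stepVec du = e.1 := by rw [hrev]; exact tgt_tgt_rev e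
  rw [h2] at h1
  obtain ⟨y, hy, hyc⟩ := hV.src_mem
  exact h1 y hy hyc

/-- **(31)**: after the examination of `v = tgt e` at time `m`, as long as `x = v + du` is undetermined, the explored region meets `E_{v,x}`
(at `v`'s departure anchor) only inside the stub `H^{j_x}_{v,x}` revealed at time `m`. [cite: KozmaNitzan2024, §4 p. 27 ((31))] -/
theorem mem_Stub_of_mem_V_of_mem_Efar {n m : ℕ} (hm : m < n) {e : Site 2 × MDir}
    (hc : ((S.scheme G).stN m ω).choice = some e) (hV : S.Valid G (S.hst G ω m) e)
    (hD : (S.scheme G).E.next (S.hst G ω m) = some (S.probe G (S.hst G ω m) e (S.aOf G (S.hst G ω m) e))) {du : MDir}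
    (hv : ¬((S.scheme G).stN n ω).Det (tgt e + stepVec du)) {y : V} (hyV : y ∈ S.Vx G (S.hst G ω n))
    (hyE : y ∈ S.Γ.Efar (S.dOf G ω (S.hst G ω m) e) (tgt e) du) :
    y ∈ S.Γ.Stub (S.dOf G ω (S.hst G ω m) e) (tgt e) du
      (S.jOf G (S.hst G ω m) e (S.aOf G (S.hst G ω m) e) (S.dOf G ω (S.hst G ω m) e) du (S.oOf G ω (S.hst G ω m) e)) := by
  have hdu : du ∈ S.onward G (S.hst G ω m) (tgt e) := mem_onward_of_not_det hΓ hsep hm.le hv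
  have hv0 : tgt e + stepVec du ≠ 0 := fun h => hv (by rw [h]; exact Or.inl (zero_mem_occ n))
  have hyE' := hsep.Efar_subset_Btw_union_Q _ _ _ hyE
  rcases (runInv hΓ ω n).V_cases y hyV with hy0 | ⟨m', hm', e', hc', -, hD', hy'⟩
  · exfalso
    rcases Finset.mem_union.1 hyE' with h | h
    · exact Finset.disjoint_left.1 (hsep.Q_disjoint_Btw _ _ 0 (tgt e) du) hy0 h
    · exact Finset.disjoint_left.1 (hsep.Q_disjoint_Q _ _ _ _ hv0.symm) hy0 h
  · by_cases hmm : m' = m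
    · subst hmm
      rw [hc] at hc'
      cases Option.some_injective _ hc'
      rcases Finset.mem_union.1 hy' with hy' | hy'
      · exact absurd hyE (Finset.disjoint_left.1 (hsep.Ewv_disjoint_Efar _ _ e.1 e.2 du (du_ne_rev hV hdu)) hy')
      · obtain ⟨du'', -, hy'⟩ := Finset.mem_biUnion.1 hy'
        by_cases hdd : du'' = du
        · subst hdd; exact hy'
        · exfalso
          rcases Finset.mem_union.1 (hsep.Stub_subset_Q_union_Btw _ _ _ _ _ (S.Γ.anchor_mem _ _ _) (S.jOf_lt _ _ _ _ _ _) hy') with h | h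
          · exact Finset.disjoint_left.1 (hsep.Q_disjoint_Efar _ _ _ _) h hyE
          · exact Finset.disjoint_left.1 (hsep.Btw_disjoint_Efar _ _ _ _ _ hdd) h hyE
    · exfalso
      have hv' : tgt e' ≠ tgt e + stepVec du := fun h => hv (h ▸ det_tgt_of_probe hm' hc' hD')
      have hv'w : tgt e' ≠ tgt e := fun h => hmm (probe_time_unique hc hD hc' hD' h)
      have hw' : e'.1 ≠ tgt e + stepVec du := fun h =>
        hv (h ▸ Or.inl ((S.scheme G).occ_stN_mono ω hm'.le (HState.cand_of_choice hc').1))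
      obtain ⟨h1, h2⟩ := newRegion_disjoint hsep _ _ (S.Γ.anchor_mem _ _ _) _ hv' hv'w hw' hy'
      rcases Finset.mem_union.1 hyE' with h | h
      · exact h1 h
      · exact h2 h

/-- **(31) at the root cell**: as long as `x = 0 + du` is undetermined, the explored region avoids `E_{0,x}` (any anchor).
[cite: KozmaNitzan2024, §4 p. 28 ((E₁ ∪ E_{w,v}) ∩ E_i = E₁)] -/
theorem not_mem_Ewv_root_of_mem_V {n : ℕ} {du : MDir} (hv : ¬((S.scheme G).stN n ω).Det ((0 : Site 2) + stepVec du))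
    {b : A} {y : V} (hyV : y ∈ S.Vx G (S.hst G ω n)) : y ∉ S.Γ.Ewv b 0 du := by
  have hv0 : (0 : Site 2) + stepVec du ≠ 0 := fun h => hv (by rw [h]; exact Or.inl (zero_mem_occ n))
  intro hyE
  rcases (runInv hΓ ω n).V_cases y hyV with hy0 | ⟨m', hm', e', hc', -, hD', hy'⟩
  · rcases Finset.mem_union.1 hyE with h | h
    · exact Finset.disjoint_left.1 (hsep.Q_disjoint_Btw _ _ 0 0 du) hy0 h
    · exact Finset.disjoint_left.1 (hsep.Q_disjoint_Q _ _ _ _ hv0.symm) hy0 h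
  · have hv' : tgt e' ≠ 0 + stepVec du := fun h => hv (h ▸ det_tgt_of_probe hm' hc' hD')
    have hv'w : tgt e' ≠ 0 := fun h => (HState.cand_of_choice hc').2 (h ▸ Or.inl (zero_mem_occ m'))
    have hw' : e'.1 ≠ 0 + stepVec du := fun h =>
      hv (h ▸ Or.inl ((S.scheme G).occ_stN_mono ω hm'.le (HState.cand_of_choice hc').1))
    obtain ⟨h1, h2⟩ := newRegion_disjoint hsep _ _ (S.Γ.anchor_mem _ _ _) _ hv' hv'w hw' hy'
    rcases Finset.mem_union.1 hyE with h | h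
    · exact h1 h
    · exact h2 h

end KSchA

end KNCells

end Transplant

end Summit.CriticalPhenomena.PercolationContinuityZ3.Theorems

end
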